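import Summits.RiemannHypothesis.RiemannHypothesis.Theorems.GapsEvoDoorsPWFourier
import Summits.RiemannHypothesis.RiemannHypothesis.Theorems.GapsEvoDoorsSincTransform

/-!
# GapsEvoDoors — PW-SOS witness port, part 3: the frequency-side profile `P̂ = λ²Q + Q″/(4π²)`

Cell rh-gaps (D-0143/D-0145), route `GapsEvoDoors`; kernel port of engine EVO-TF-2's certified
two-square Paley–Wiener SOS witnesses of record. Generic in the coefficient list `Q` (the
autocorrelation polynomial `Σ Wᵢ (Hᵢ ⋆ Hᵢ)` on `[0, K]`) and the window `K`:

* two integrations by parts on `[0, K]`: `∫₀ᴷ Q″ cos(w·) = −w² ∫₀ᴷ Q cos(w·)` when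
  `Q(K) = Q′(K) = Q′(0) = 0` (`integral_deriv2_mul_cos`), and the decay bound
  `|∫₀ᴷ P cos(w·)| ≤ (|P′(K)| + |P′(0)| + ∫₀ᴷ|P″|)/w²` when `P(K) = 0`
  (`abs_integral_eval_mul_cos_le`);
* for `P̂(α) = λ²Q(|α|) + Q″(|α|)/(4π²)` on `[−K, K]` (`phat`): `(P̂)ˇ(u) = (λ² − u²)·Q̌(u)`
  (`cosTransform_phat`, the Fourier-side form of `r(u) = (λ² − u²)·S(u)`), `(P̂)ˇ ∈ L¹`
  (`integrable_cosTransform_phat`), Fourier inversion `((P̂)ˇ)^ = P̂` (reusing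
  `GapsEvoDoorsSinc.cosTransform_cosTransform`), and `(P̂)ˇ(0) = 2λ²∫₀ᴷ Q`.

Pure real/Fourier analysis; no RH, no zeta; nothing here bears on the truth of RH.
-/

noncomputable section

open MeasureTheory Set Real Filter Topology
open scoped FourierTransform Convolution
open Literature.NumberTheory.LFunctions Literature.NumberTheory.LFunctions.BGMM2023

set_option linter.dupNamespace false  -- the mandated namespace repeats `RiemannHypothesis`

namespace Summit.RiemannHypothesis.RiemannHypothesis.Theorems.GapsEvoDoorsPW

attribute [local fun_prop] Poly.continuous_eval

/-! ## Integration by parts on `[0, K]` -/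

/-- **Two integrations by parts**: `∫₀ᴷ Q''(x) cos(wx) dx = −w² ∫₀ᴷ Q(x) cos(wx) dx` whenever
`Q(K) = Q'(K) = Q'(0) = 0`. -/
theorem integral_deriv2_mul_cos (Q : Poly) {K : ℚ} (h1 : Poly.evalQ Q K = 0)
    (h2 : Poly.evalQ (Poly.deriv Q) K = 0) (h3 : Poly.evalQ (Poly.deriv Q) 0 = 0) (w : ℝ) :
    ∫ x in (0 : ℝ)..K, Poly.eval (Poly.deriv (Poly.deriv Q)) x * Real.cos (w * x) =
      -w ^ 2 * ∫ x in (0 : ℝ)..K, Poly.eval Q x * Real.cos (w * x) := by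
  have hK1 : Poly.eval Q (K : ℝ) = 0 := by rw [Poly.eval_ratCast, h1, Rat.cast_zero]
  have hK2 : Poly.eval (Poly.deriv Q) (K : ℝ) = 0 := by rw [Poly.eval_ratCast, h2, Rat.cast_zero]
  have h02 : Poly.eval (Poly.deriv Q) 0 = 0 := by
    have h := Poly.eval_ratCast (Poly.deriv Q) 0
    push_cast at h
    rw [h, h3, Rat.cast_zero]
  have s1 := intervalIntegral.integral_mul_deriv_eq_deriv_mul (a := (0 : ℝ)) (b := K)
    (u := fun x ↦ Real.cos (w * x)) (u' := fun x ↦ -w * Real.sin (w * x))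
    (v := Poly.eval (Poly.deriv Q)) (v' := Poly.eval (Poly.deriv (Poly.deriv Q)))
    (fun x _ ↦ GapsEvoDoorsSinc.hasDerivAt_cos_mul w x) (fun x _ ↦ Poly.hasDerivAt_eval _ x)
    ((by fun_prop : Continuous fun x ↦ -w * Real.sin (w * x)).intervalIntegrable _ _)
    ((Poly.continuous_eval _).intervalIntegrable _ _)
  have s2 := intervalIntegral.integral_mul_deriv_eq_deriv_mul (a := (0 : ℝ)) (b := K)
    (u := fun x ↦ Real.sin (w * x)) (u' := fun x ↦ w * Real.cos (w * x))
    (v := Poly.eval Q) (v' := Poly.eval (Poly.deriv Q))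
    (fun x _ ↦ GapsEvoDoorsSinc.hasDerivAt_sin_mul w x) (fun x _ ↦ Poly.hasDerivAt_eval _ x)
    ((by fun_prop : Continuous fun x ↦ w * Real.cos (w * x)).intervalIntegrable _ _)
    ((Poly.continuous_eval _).intervalIntegrable _ _)
  simp only [hK2, h02, hK1, mul_zero, Real.sin_zero, zero_mul, zero_sub, sub_self] at s1 s2
  have e1 : ∫ x in (0 : ℝ)..K, Poly.eval (Poly.deriv (Poly.deriv Q)) x * Real.cos (w * x) =
      ∫ x in (0 : ℝ)..K, Real.cos (w * x) * Poly.eval (Poly.deriv (Poly.deriv Q)) x :=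
    intervalIntegral.integral_congr fun x _ ↦ mul_comm _ _
  have e3 : ∫ x in (0 : ℝ)..K, -w * Real.sin (w * x) * Poly.eval (Poly.deriv Q) x =
      -w * ∫ x in (0 : ℝ)..K, Real.sin (w * x) * Poly.eval (Poly.deriv Q) x := by
    rw [← intervalIntegral.integral_const_mul]
    exact intervalIntegral.integral_congr fun x _ ↦ by ring
  have e4 : ∫ x in (0 : ℝ)..K, w * Real.cos (w * x) * Poly.eval Q x =
      w * ∫ x in (0 : ℝ)..K, Poly.eval Q x * Real.cos (w * x) := by
    rw [← intervalIntegral.integral_const_mul]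
    exact intervalIntegral.integral_congr fun x _ ↦ by ring
  rw [e1, s1, e3, s2, e4]
  ring

/-- **Decay by two integrations by parts**: if `P(K) = 0` and `w ≠ 0` then
`∫₀ᴷ P cos(w·) = (P'(K) cos(wK) − P'(0) − ∫₀ᴷ P'' cos(w·))/w²`. -/
theorem integral_eval_mul_cos_eq (P : Poly) {K : ℚ} (hP : Poly.evalQ P K = 0) {w : ℝ}
    (hw : w ≠ 0) :
    ∫ x in (0 : ℝ)..K, Poly.eval P x * Real.cos (w * x) =
      (Poly.eval (Poly.deriv P) K * Real.cos (w * K) - Poly.eval (Poly.deriv P) 0 -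
        ∫ x in (0 : ℝ)..K, Poly.eval (Poly.deriv (Poly.deriv P)) x * Real.cos (w * x)) / w ^ 2 := by
  have hK1 : Poly.eval P (K : ℝ) = 0 := by rw [Poly.eval_ratCast, hP, Rat.cast_zero]
  have s1 := intervalIntegral.integral_mul_deriv_eq_deriv_mul (a := (0 : ℝ)) (b := K)
    (u := Poly.eval P) (u' := Poly.eval (Poly.deriv P))
    (v := fun x ↦ Real.sin (w * x) / w) (v' := fun x ↦ Real.cos (w * x))
    (fun x _ ↦ Poly.hasDerivAt_eval _ x)
    (fun x _ ↦ ((GapsEvoDoorsSinc.hasDerivAt_sin_mul w x).div_const w).congr_deriv (by field_simp))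
    ((Poly.continuous_eval _).intervalIntegrable _ _)
    ((by fun_prop : Continuous fun x ↦ Real.cos (w * x)).intervalIntegrable _ _)
  have s2 := intervalIntegral.integral_mul_deriv_eq_deriv_mul (a := (0 : ℝ)) (b := K)
    (u := Poly.eval (Poly.deriv P)) (u' := Poly.eval (Poly.deriv (Poly.deriv P)))
    (v := fun x ↦ -Real.cos (w * x) / w ^ 2) (v' := fun x ↦ Real.sin (w * x) / w)
    (fun x _ ↦ Poly.hasDerivAt_eval _ x)
    (fun x _ ↦ (((GapsEvoDoorsSinc.hasDerivAt_cos_mul w x).neg).div_const (w ^ 2)).congr_deriv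
      (by rw [div_eq_div_iff (pow_ne_zero 2 hw) hw]; ring))
    ((Poly.continuous_eval _).intervalIntegrable _ _)
    ((by fun_prop : Continuous fun x ↦ Real.sin (w * x) / w).intervalIntegrable _ _)
  simp only [hK1, mul_zero, Real.sin_zero, zero_div, Real.cos_zero, zero_mul, sub_zero,
    zero_sub, mul_zero] at s1 s2
  rw [s1, s2]
  have e : ∫ x in (0 : ℝ)..K, Poly.eval (Poly.deriv (Poly.deriv P)) x * (-Real.cos (w * x) / w ^ 2) =
      -(∫ x in (0 : ℝ)..K, Poly.eval (Poly.deriv (Poly.deriv P)) x * Real.cos (w * x)) / w ^ 2 := by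
    rw [← intervalIntegral.integral_neg, ← intervalIntegral.integral_div]
    exact intervalIntegral.integral_congr fun x _ ↦ by ring
  rw [e]
  field_simp
  ring

/-- The decay BOUND: `|∫₀ᴷ P cos(w·)| ≤ (|P'(K)| + |P'(0)| + ∫₀ᴷ |P''|)/w²` for `P(K) = 0`,
`K ≥ 0`, `w ≠ 0`. -/
theorem abs_integral_eval_mul_cos_le (P : Poly) {K : ℚ} (hK : 0 ≤ K) (hP : Poly.evalQ P K = 0)
    {w : ℝ} (hw : w ≠ 0) :
    |∫ x in (0 : ℝ)..K, Poly.eval P x * Real.cos (w * x)| ≤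
      (|Poly.eval (Poly.deriv P) K| + |Poly.eval (Poly.deriv P) 0| +
        ∫ x in (0 : ℝ)..K, |Poly.eval (Poly.deriv (Poly.deriv P)) x|) / w ^ 2 := by
  rw [integral_eval_mul_cos_eq P hP hw, abs_div, abs_of_pos (by positivity : (0 : ℝ) < w ^ 2)]
  refine div_le_div_of_nonneg_right ?_ (by positivity)
  have hK' : (0 : ℝ) ≤ K := by exact_mod_cast hK
  have hI : |∫ x in (0 : ℝ)..K, Poly.eval (Poly.deriv (Poly.deriv P)) x * Real.cos (w * x)| ≤
      ∫ x in (0 : ℝ)..K, |Poly.eval (Poly.deriv (Poly.deriv P)) x| := by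
    refine (intervalIntegral.abs_integral_le_integral_abs hK').trans ?_
    refine intervalIntegral.integral_mono_on hK' ?_ ?_ fun x _ ↦ ?_
    · exact ((Poly.continuous_eval _).mul (by fun_prop)).abs.intervalIntegrable _ _
    · exact (Poly.continuous_eval _).abs.intervalIntegrable _ _
    · rw [abs_mul]
      exact mul_le_of_le_one_right (abs_nonneg _) (Real.abs_cos_le_one _)
  have h1 : |Poly.eval (Poly.deriv P) K * Real.cos (w * K)| ≤ |Poly.eval (Poly.deriv P) K| := by
    rw [abs_mul]
    exact mul_le_of_le_one_right (abs_nonneg _) (Real.abs_cos_le_one _)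
  set x := Poly.eval (Poly.deriv P) K * Real.cos (w * K)
  set y := Poly.eval (Poly.deriv P) 0
  set z := ∫ x in (0 : ℝ)..K, Poly.eval (Poly.deriv (Poly.deriv P)) x * Real.cos (w * x)
  have T : |x - y - z| ≤ |x| + |y| + |z| :=
    abs_le.2 ⟨by linarith [neg_abs_le x, le_abs_self y, le_abs_self z],
      by linarith [le_abs_self x, neg_abs_le y, neg_abs_le z]⟩
  linarith

/-- A continuous function bounded by `C₀` and by `C/u²` is integrable. -/
theorem integrable_of_abs_le_inv_sq {g : ℝ → ℝ} (hg : Continuous g) {C₀ C : ℝ}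
    (h0 : ∀ u, |g u| ≤ C₀) (h1 : ∀ u, u ≠ 0 → |g u| ≤ C / u ^ 2) : Integrable g := by
  have key : ∀ u : ℝ, ‖g u‖ ≤ 2 * (C₀ + |C|) * (1 + u ^ 2)⁻¹ := by
    intro u
    rw [Real.norm_eq_abs]
    have hC0 : 0 ≤ C₀ := (abs_nonneg _).trans (h0 0)
    have hpos : 0 < 1 + u ^ 2 := by positivity
    rw [← div_eq_mul_inv, le_div_iff₀ hpos]
    rcases le_or_gt (|u|) 1 with hu | hu
    · have hu2 : u ^ 2 ≤ 1 := by rw [← sq_abs]; exact pow_le_one₀ (abs_nonneg _) hu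
      nlinarith [h0 u, abs_nonneg C]
    · have hu0 : u ≠ 0 := fun h ↦ by rw [h, abs_zero] at hu; linarith
      have hu2 : 1 ≤ u ^ 2 := by rw [← sq_abs]; exact one_le_pow₀ hu.le
      have hb := h1 u hu0
      have hb' : |g u| * u ^ 2 ≤ C := by rwa [le_div_iff₀ (by positivity)] at hb
      nlinarith [abs_nonneg (g u), le_abs_self C]
  exact ((integrable_inv_one_add_sq).const_mul _).mono' hg.aestronglyMeasurable
    (Eventually.of_forall key)

/-! ## The frequency-side profile `P̂ = λ²Q + Q''/(4π²)` on `[−K, K]` -/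

/-- The frequency-side function `P̂(α) = λ² Q(|α|) + Q''(|α|)/(4π²)` for `|α| ≤ K`, else `0`. -/
def phat (Q : Poly) (K : ℚ) (lam : ℝ) : ℝ → ℝ :=
  evenExt (fun x ↦ lam ^ 2 * Poly.eval Q x + Poly.eval (Poly.deriv (Poly.deriv Q)) x / (4 * π ^ 2)) K

/-- The even extension of `Q` itself. -/
def qext (Q : Poly) (K : ℚ) : ℝ → ℝ := evenExt (Poly.eval Q) K

/-- `P̂` is even. -/
theorem phat_neg (Q : Poly) (K : ℚ) (lam α : ℝ) : phat Q K lam (-α) = phat Q K lam α :=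
  evenExt_neg _ _ _

/-- `P̂ ∈ L¹`. -/
theorem integrable_phat (Q : Poly) (K : ℚ) (lam : ℝ) : Integrable (phat Q K lam) :=
  integrable_evenExt (by fun_prop : Continuous fun x ↦ lam ^ 2 * Poly.eval Q x +
    Poly.eval (Poly.deriv (Poly.deriv Q)) x / (4 * π ^ 2)) _

/-- `P̂` is continuous when `Q(K) = Q''(K) = 0`. -/
theorem continuous_phat (Q : Poly) {K : ℚ} (lam : ℝ) (h1 : Poly.evalQ Q K = 0)
    (h4 : Poly.evalQ (Poly.deriv (Poly.deriv Q)) K = 0) : Continuous (phat Q K lam) := by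
  refine continuous_evenExt (by fun_prop) ?_
  rw [Poly.eval_ratCast, Poly.eval_ratCast, h1, h4]
  simp

/-- **`(P̂)ˇ = (λ² − u²)·Q̌`**: the cosine transform of `P̂` is `(λ² − u²)` times that of the even
extension of `Q` (two integrations by parts; `Q(K) = Q'(K) = Q'(0) = 0`). -/
theorem cosTransform_phat (Q : Poly) {K : ℚ} (hK : 0 ≤ K) (lam : ℝ) (h1 : Poly.evalQ Q K = 0)
    (h2 : Poly.evalQ (Poly.deriv Q) K = 0) (h3 : Poly.evalQ (Poly.deriv Q) 0 = 0) (u : ℝ) :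
    cosTransform (phat Q K lam) u = (lam ^ 2 - u ^ 2) * cosTransform (qext Q K) u := by
  have hK' : (0 : ℝ) ≤ K := by exact_mod_cast hK
  unfold phat qext
  rw [cosTransform_evenExt (by fun_prop) hK', cosTransform_evenExt (Poly.continuous_eval Q) hK']
  have hsplit : ∫ α in (0 : ℝ)..K, (lam ^ 2 * Poly.eval Q α +
      Poly.eval (Poly.deriv (Poly.deriv Q)) α / (4 * π ^ 2)) * Real.cos (2 * π * u * α) =
      lam ^ 2 * (∫ α in (0 : ℝ)..K, Poly.eval Q α * Real.cos (2 * π * u * α)) +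
      (∫ α in (0 : ℝ)..K, Poly.eval (Poly.deriv (Poly.deriv Q)) α * Real.cos (2 * π * u * α)) /
        (4 * π ^ 2) := by
    rw [← intervalIntegral.integral_const_mul, ← intervalIntegral.integral_div,
      ← intervalIntegral.integral_add]
    · exact intervalIntegral.integral_congr fun α _ ↦ by ring
    · exact ((Poly.continuous_eval Q).mul (by fun_prop)).const_mul _ |>.intervalIntegrable _ _
    · exact (((Poly.continuous_eval _).mul (by fun_prop)).div_const _).intervalIntegrable _ _
  have hparts := integral_deriv2_mul_cos Q h1 h2 h3 (2 * π * u)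
  have e : (fun α : ℝ ↦ Poly.eval (Poly.deriv (Poly.deriv Q)) α * Real.cos (2 * π * u * α)) =
      fun α ↦ Poly.eval (Poly.deriv (Poly.deriv Q)) α * Real.cos ((2 * π * u) * α) := rfl
  rw [hsplit, hparts]
  have hπ : π ≠ 0 := Real.pi_ne_zero
  field_simp
  ring

/-- **`(P̂)ˇ ∈ L¹`** (`Q(K) = Q''(K) = 0`): bounded, and `O(1/u²)` by the decay bound. -/
theorem integrable_cosTransform_phat (Q : Poly) {K : ℚ} (hK : 0 ≤ K) (lam : ℝ)
    (h1 : Poly.evalQ Q K = 0) (h4 : Poly.evalQ (Poly.deriv (Poly.deriv Q)) K = 0) :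
    Integrable (cosTransform (phat Q K lam)) := by
  have hK' : (0 : ℝ) ≤ K := by exact_mod_cast hK
  have hev := phat_neg Q K lam
  have hint := integrable_phat Q K lam
  refine integrable_of_abs_le_inv_sq (continuous_cosTransform hev hint)
    (C₀ := ∫ α, |phat Q K lam α|) (fun u ↦ abs_cosTransform_le hint u)
    (C := 2 * (lam ^ 2 * ((|Poly.eval (Poly.deriv Q) K| + |Poly.eval (Poly.deriv Q) 0| +
        ∫ x in (0 : ℝ)..K, |Poly.eval (Poly.deriv (Poly.deriv Q)) x|) / (2 * π) ^ 2) +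
      ((|Poly.eval (Poly.deriv (Poly.deriv (Poly.deriv Q))) K| +
        |Poly.eval (Poly.deriv (Poly.deriv (Poly.deriv Q))) 0| +
        ∫ x in (0 : ℝ)..K, |Poly.eval (Poly.deriv (Poly.deriv (Poly.deriv (Poly.deriv Q)))) x|) /
          (2 * π) ^ 2) / (4 * π ^ 2))) fun u hu ↦ ?_
  unfold phat
  rw [cosTransform_evenExt (by fun_prop) hK']
  have hw : 2 * π * u ≠ 0 := mul_ne_zero (mul_ne_zero two_ne_zero Real.pi_ne_zero) hu
  have hsplit : ∫ α in (0 : ℝ)..K, (lam ^ 2 * Poly.eval Q α +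
      Poly.eval (Poly.deriv (Poly.deriv Q)) α / (4 * π ^ 2)) * Real.cos (2 * π * u * α) =
      lam ^ 2 * (∫ α in (0 : ℝ)..K, Poly.eval Q α * Real.cos ((2 * π * u) * α)) +
      (∫ α in (0 : ℝ)..K, Poly.eval (Poly.deriv (Poly.deriv Q)) α * Real.cos ((2 * π * u) * α)) /
        (4 * π ^ 2) := by
    rw [← intervalIntegral.integral_const_mul, ← intervalIntegral.integral_div,
      ← intervalIntegral.integral_add]
    · exact intervalIntegral.integral_congr fun α _ ↦ by ring
    · exact ((Poly.continuous_eval Q).mul (by fun_prop)).const_mul _ |>.intervalIntegrable _ _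
    · exact (((Poly.continuous_eval _).mul (by fun_prop)).div_const _).intervalIntegrable _ _
  rw [hsplit]
  have bA := abs_integral_eval_mul_cos_le Q hK h1 hw
  have bB := abs_integral_eval_mul_cos_le (Poly.deriv (Poly.deriv Q)) hK h4 hw
  have hπ : 0 < π := Real.pi_pos
  have hu2 : 0 < u ^ 2 := by positivity
  have hw2 : (2 * π * u) ^ 2 = (2 * π) ^ 2 * u ^ 2 := by ring
  rw [hw2] at bA bB
  rw [abs_mul, abs_two]
  set IA := ∫ α in (0 : ℝ)..K, Poly.eval Q α * Real.cos ((2 * π * u) * α)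
  set IB := ∫ α in (0 : ℝ)..K, Poly.eval (Poly.deriv (Poly.deriv Q)) α * Real.cos ((2 * π * u) * α)
  set CA := |Poly.eval (Poly.deriv Q) K| + |Poly.eval (Poly.deriv Q) 0| +
        ∫ x in (0 : ℝ)..K, |Poly.eval (Poly.deriv (Poly.deriv Q)) x|
  set CB := |Poly.eval (Poly.deriv (Poly.deriv (Poly.deriv Q))) K| +
        |Poly.eval (Poly.deriv (Poly.deriv (Poly.deriv Q))) 0| +
        ∫ x in (0 : ℝ)..K, |Poly.eval (Poly.deriv (Poly.deriv (Poly.deriv (Poly.deriv Q)))) x|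
  have h4π : (0 : ℝ) < 4 * π ^ 2 := by positivity
  have e1 : |lam ^ 2 * IA + IB / (4 * π ^ 2)| ≤ lam ^ 2 * |IA| + |IB| / (4 * π ^ 2) := by
    have T : |lam ^ 2 * IA + IB / (4 * π ^ 2)| ≤ |lam ^ 2 * IA| + |IB / (4 * π ^ 2)| :=
      abs_le.2 ⟨by linarith [neg_abs_le (lam ^ 2 * IA), neg_abs_le (IB / (4 * π ^ 2))],
        by linarith [le_abs_self (lam ^ 2 * IA), le_abs_self (IB / (4 * π ^ 2))]⟩
    rw [abs_mul, abs_div, abs_of_nonneg (sq_nonneg lam), abs_of_pos h4π] at T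
    exact T
  have eA : lam ^ 2 * |IA| ≤ lam ^ 2 * (CA / ((2 * π) ^ 2 * u ^ 2)) :=
    mul_le_mul_of_nonneg_left bA (sq_nonneg _)
  have eB : |IB| / (4 * π ^ 2) ≤ CB / ((2 * π) ^ 2 * u ^ 2) / (4 * π ^ 2) :=
    div_le_div_of_nonneg_right bB h4π.le
  have final : 2 * |lam ^ 2 * IA + IB / (4 * π ^ 2)| ≤
      2 * (lam ^ 2 * (CA / ((2 * π) ^ 2 * u ^ 2)) + CB / ((2 * π) ^ 2 * u ^ 2) / (4 * π ^ 2)) := by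
    linarith
  refine final.trans (le_of_eq ?_)
  field_simp

/-- **Fourier inversion for `P̂`**: the cosine transform of `(P̂)ˇ` is `P̂`. -/
theorem cosTransform_cosTransform_phat (Q : Poly) {K : ℚ} (hK : 0 ≤ K) (lam : ℝ)
    (h1 : Poly.evalQ Q K = 0) (h4 : Poly.evalQ (Poly.deriv (Poly.deriv Q)) K = 0) (α : ℝ) :
    cosTransform (cosTransform (phat Q K lam)) α = phat Q K lam α :=
  GapsEvoDoorsSinc.cosTransform_cosTransform (continuous_phat Q lam h1 h4) (integrable_phat Q K lam)
    (phat_neg Q K lam) (integrable_cosTransform_phat Q hK lam h1 h4) α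

/-- **Value at the origin**: `(P̂)ˇ(0) = 2λ² ∫₀ᴷ Q` (the `Q''` part integrates to
`Q'(K) − Q'(0) = 0`). -/
theorem cosTransform_phat_zero (Q : Poly) {K : ℚ} (hK : 0 ≤ K) (lam : ℝ)
    (h2 : Poly.evalQ (Poly.deriv Q) K = 0) (h3 : Poly.evalQ (Poly.deriv Q) 0 = 0) :
    cosTransform (phat Q K lam) 0 = 2 * lam ^ 2 * (Poly.intQ Q 0 K : ℝ) := by
  have hK' : (0 : ℝ) ≤ K := by exact_mod_cast hK
  unfold phat
  rw [cosTransform_evenExt (by fun_prop) hK']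
  simp only [mul_zero, zero_mul, Real.cos_zero, mul_one]
  rw [intervalIntegral.integral_add, intervalIntegral.integral_const_mul,
    intervalIntegral.integral_div]
  · have hQ := Poly.integral_eval_rat Q 0 K
    have hD : ∫ x in ((0 : ℚ) : ℝ)..((K : ℚ) : ℝ), Poly.eval (Poly.deriv (Poly.deriv Q)) x = 0 := by
      rw [intervalIntegral.integral_eq_sub_of_hasDerivAt (fun x _ ↦ Poly.hasDerivAt_eval _ x)
        ((Poly.continuous_eval _).intervalIntegrable _ _), Poly.eval_ratCast, Poly.eval_ratCast,
        h2, h3]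
      simp
    push_cast at hQ hD
    rw [hQ, hD]
    ring
  · exact ((Poly.continuous_eval Q).const_mul _).intervalIntegrable _ _
  · exact ((Poly.continuous_eval _).div_const _).intervalIntegrable _ _

end Summit.RiemannHypothesis.RiemannHypothesis.Theorems.GapsEvoDoorsPW

end
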